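import Summits.Ventures.PercRepro.SubdivisionLift

/-!
# C-005 reduces to reduced networks (live degrees)

A **live series vertex** (`IsSeriesLive`) is an unmarked vertex `x` whose LIVE edges are exactly
two, `e₁ = {y, x}` and `e₂ = {x, z}` — dead edges at `x` are allowed, unlike in typer-2's
`IsSeries`. Parking the dead edges at `x` as loops at `y` (`parkDead`) changes no partition
probability (`prob_partitionEvent_congr_of_live`, `SubdivisionLift.lean`) and produces a genuine
series vertex (`IsSeriesLive.isSeries_parkDead`), so the series substitution applies
(`IsSeriesLive.prob_partitionEvent`) and C-005 transports backwards (`C005At_of_isSeriesLive`).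

An instance is **reduced** (`IsReduced`) when it has no live parallel pair and no live series
vertex away from the marks. Each substitution strictly shrinks the set of live edges, so by strong
induction **C-005 on the reduced instances gives C-005 on every instance**
(`C005At_of_forall_isReduced` on a fixed edge type, `C005_of_C005Reduced` for the conjecture of
record `C005`): the conjecture is one about networks in which every unmarked vertex has live
degree `≠ 2` and no two live edges are parallel.
-/

namespace PercRepro

namespace MultiGraph

open Finset

variable {V E : Type}

/-- **A live series vertex**: `x` is unmarked (the caller's business), its live edges are exactly
`e₁ = {y, x}` and `e₂ = {x, z}`, and dead edges at `x` are allowed. -/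
structure IsSeriesLive (G : MultiGraph V E) (p : E → ℝ) (e₁ e₂ : E) (x y z : V) : Prop where
  live₁ : p e₁ ≠ 0
  live₂ : p e₂ ≠ 0
  ne : e₁ ≠ e₂
  end₁ : (G.fst e₁ = y ∧ G.snd e₁ = x) ∨ (G.fst e₁ = x ∧ G.snd e₁ = y)
  end₂ : (G.fst e₂ = x ∧ G.snd e₂ = z) ∨ (G.fst e₂ = z ∧ G.snd e₂ = x)
  yx : y ≠ x
  zx : z ≠ x
  deg : ∀ e, p e ≠ 0 → G.fst e = x ∨ G.snd e = x → e = e₁ ∨ e = e₂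

open Classical in
/-- The graph in which every dead edge of `p` incident to `x` is re-attached as a loop at `y`. -/
noncomputable def parkDead (G : MultiGraph V E) (p : E → ℝ) (x y : V) : MultiGraph V E where
  fst e := if p e = 0 ∧ (G.fst e = x ∨ G.snd e = x) then y else G.fst e
  snd e := if p e = 0 ∧ (G.fst e = x ∨ G.snd e = x) then y else G.snd e

/-- Parking dead edges changes no live edge. -/
theorem parkDead_agree_live (G : MultiGraph V E) (p : E → ℝ) (x y : V) :
    ∀ e, p e ≠ 0 → G.fst e = (G.parkDead p x y).fst e ∧ G.snd e = (G.parkDead p x y).snd e := by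
  intro e he
  simp [parkDead, he]

/-- After parking the dead edges a live series vertex is a series vertex. -/
theorem IsSeriesLive.isSeries_parkDead {G : MultiGraph V E} {p : E → ℝ} {e₁ e₂ : E} {x y z : V}
    (h : G.IsSeriesLive p e₁ e₂ x y z) : (G.parkDead p x y).IsSeries e₁ e₂ x y z := by
  have h1 := parkDead_agree_live G p x y e₁ h.live₁
  have h2 := parkDead_agree_live G p x y e₂ h.live₂
  refine ⟨h.ne, ?_, ?_, h.yx, h.zx, ?_⟩
  · rw [← h1.1, ← h1.2]
    exact h.end₁
  · rw [← h2.1, ← h2.2]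
    exact h.end₂
  · intro e he
    by_cases hd : p e = 0 ∧ (G.fst e = x ∨ G.snd e = x)
    · exfalso
      have hf : (G.parkDead p x y).fst e = y := by simp [parkDead, hd]
      have hs : (G.parkDead p x y).snd e = y := by simp [parkDead, hd]
      rw [hf, hs] at he
      rcases he with he | he <;> exact h.yx he
    · have hf : (G.parkDead p x y).fst e = G.fst e := by simp [parkDead, hd]
      have hs : (G.parkDead p x y).snd e = G.snd e := by simp [parkDead, hd]
      rw [hf, hs] at he
      by_cases hp : p e = 0
      · exact absurd ⟨hp, he⟩ hd
      · exact h.deg e hp he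

variable [Fintype E] [DecidableEq E]

/-- **The series substitution at a live series vertex**: for marks avoiding `x`, the partition
probabilities of `(G, p)` are those of the reduced instance. -/
theorem IsSeriesLive.prob_partitionEvent {G : MultiGraph V E} {p : E → ℝ} {e₁ e₂ : E} {x y z : V}
    (h : G.IsSeriesLive p e₁ e₂ x y z) {k : ℕ} {m : Fin k → V} (hm : ∀ i, m i ≠ x)
    (rgs : Fin k → ℕ) :
    prob p (G.partitionEvent m rgs) =
      prob (serWeight p e₁ e₂) (((G.parkDead p x y).seriesGraph e₁ y z).partitionEvent m rgs) := by
  rw [prob_partitionEvent_congr_of_live p (parkDead_agree_live G p x y) m rgs]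
  exact h.isSeries_parkDead.prob_partitionEvent p hm rgs

/-- **C-005 transports backwards through a live series vertex.** -/
theorem C005At_of_isSeriesLive {G : MultiGraph V E} {p : E → ℝ} {e₁ e₂ : E} {x y z : V}
    (h : G.IsSeriesLive p e₁ e₂ x y z) {a b c d : V} (hx : x ≠ a ∧ x ≠ b ∧ x ≠ c ∧ x ≠ d)
    (hC : ((G.parkDead p x y).seriesGraph e₁ y z).C005At (serWeight p e₁ e₂) a b c d) :
    G.C005At p a b c d := by
  unfold C005At at hC ⊢
  have hm := marks_ne_of_ne hx
  rw [h.prob_partitionEvent hm ![0, 0, 1, 1], h.prob_partitionEvent hm ![0, 1, 0, 1],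
    h.prob_partitionEvent hm ![0, 1, 1, 0], h.prob_partitionEvent hm ![0, 0, 0, 0],
    h.prob_partitionEvent hm ![0, 1, 2, 3]]
  exact hC

/-- **A reduced instance**: no two live edges are parallel and every live series vertex is a
mark. -/
def IsReduced (G : MultiGraph V E) (p : E → ℝ) (a b c d : V) : Prop :=
  (∀ e₁ e₂, e₁ ≠ e₂ → p e₁ ≠ 0 → p e₂ ≠ 0 → ¬ G.Parallel e₁ e₂) ∧
    ∀ e₁ e₂ x y z, G.IsSeriesLive p e₁ e₂ x y z → x = a ∨ x = b ∨ x = c ∨ x = d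

/-- **C-005 on the reduced instances of an edge type gives C-005 on every instance** (strong
induction on the number of live edges through the two substitutions). -/
theorem C005At_of_forall_isReduced {a b c d : V}
    (hred : ∀ (G : MultiGraph V E) (p : E → ℝ), IsProb p → G.IsReduced p a b c d →
      G.C005At p a b c d)
    (G : MultiGraph V E) (p : E → ℝ) (hp : IsProb p) : G.C005At p a b c d := by
  suffices key : ∀ n : ℕ, ∀ (G : MultiGraph V E) (q : E → ℝ), IsProb q → (liveEdges q).card = n →
      G.C005At q a b c d from key _ G p hp rfl
  intro n
  induction n using Nat.strong_induction_on with
  | _ n ih =>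
    intro G q hq hcard
    by_cases hr : G.IsReduced q a b c d
    · exact hred G q hq hr
    · unfold IsReduced at hr
      rw [not_and_or] at hr
      rcases hr with hpar | hser
      · simp only [not_forall, not_not] at hpar
        obtain ⟨e₁, e₂, hne, h₁, h₂, hpar⟩ := hpar
        have hlt : (liveEdges (parWeight q e₁ e₂)).card < n := by
          rw [← hcard]
          exact card_lt_card (liveEdges_parWeight_ssubset hne h₁ h₂)
        exact C005At_of_step (SPStep.parallel hne hpar)
          (ih _ hlt G _ (isProb_parWeight hq e₁ e₂) rfl)
      · simp only [not_forall] at hser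
        obtain ⟨e₁, e₂, x, y, z, hs, hx⟩ := hser
        simp only [not_or] at hx
        have hlt : (liveEdges (serWeight q e₁ e₂)).card < n := by
          rw [← hcard]
          exact card_lt_card (liveEdges_serWeight_ssubset hs.ne hs.live₁ hs.live₂)
        exact C005At_of_isSeriesLive hs hx
          (ih _ hlt _ _ (isProb_serWeight hq e₁ e₂) rfl)

/-- **C-005 on reduced instances** (the conjecture of record restricted to instances with no live
parallel pair and no live series vertex away from the marks). -/
def C005Reduced : Prop :=
  ∀ {V E : Type} [Fintype E] [DecidableEq E] (G : MultiGraph V E) (p : E → ℝ), IsProb p →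
    ∀ a b c d : V, G.IsReduced p a b c d → G.C005At p a b c d

/-- **WLOG reduced**: C-005 on the reduced instances is C-005 (typer-2's `C005`). -/
theorem C005_of_C005Reduced (h : C005Reduced) : C005 := by
  intro V E _ _ G p hp a b c d
  exact C005At_of_forall_isReduced (fun G p hp hr => h G p hp a b c d hr) G p hp

/-- C-005 restricted to reduced instances is a consequence of C-005. -/
theorem C005Reduced_of_C005 (h : C005) : C005Reduced := by
  intro V E _ _ G p hp a b c d _
  exact h G p hp a b c d

/-- **C-005 is equivalent to its reduced form.** -/
theorem C005_iff_C005Reduced : C005 ↔ C005Reduced :=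
  ⟨C005Reduced_of_C005, C005_of_C005Reduced⟩

end MultiGraph

end PercRepro
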